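import Summits.BirchSwinnertonDyer.Rank1Residual.O5.HeegnerLogTransportThreeBSDp
import Summits.BirchSwinnertonDyer.Rank1Residual.O5.HeegnerLogTransportThreeTwoSidedRow149895d1
import Literature.NumberTheory.EllipticCurves.ManinConstantConductorLe300000
import Literature.NumberTheory.EllipticCurves.ManinConstantSemistablePrimewise
import Literature.NumberTheory.EllipticCurves.CuspFormLFunctionLevelConductorProofs
import Literature.NumberTheory.EllipticCurves.Wuthrich2014.ThreeAdicImageSupersingularProofs
import Literature.NumberTheory.EllipticCurves.AnalyticRankModularityProofs
import Summits.BirchSwinnertonDyer.Rank1Residual.O5.HeegnerHypothesisOfDiscr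
import HarnessLib
import HarnessLib.Audit.Tags

/-!
# Heegner-log transport at `p = 3` (KL3), part 32b — STAGED by o5-r2 GEN 32, NOT farm-checked as a whole:
# its imports `O5.HeegnerLogTransportThreeBSDp` (part 32, by-sha ask A-O5-G32-1) and
# `O5.HeegnerLogTransportThreeTwoSidedRow149895d1` (25d ROW p365885; olean unbuilt at 16:05Z) were not
# both available on the farm this GEN; §1 below WAS checked standalone against the BUILT Models file
# (`gen32/scratch/TwistModel149895d1_356_scratch.lean`: rc 0, 0 warnings, axioms standard); §2 is the
# mechanical mirror of the checked `o5_bsdp_row240930b1`. GEN 33 (this copy, 32b′): whole-file farm check still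
# blocked (part 32 unplaced; the 25d ROW olean in the farm backlog, `remote:stale:…:unbuilt` this GEN, 16:2x–16:5xZ); §2 (GEN 32 text,
# unchanged) re-elaborated in `gen33/scratch/BSDpRowsSix_composition_scratch.lean` (rc 0) as real text over a sorried
# stand-in for the 25d ROW END (signature verbatim; the BUILT tree Models module imported); §3 (Manin discharge BY NAME)
# added. To be placed after part 32 and the 25d ROW build.
# The second two-sided ROW OF RECORD `149895d1 ~ 16655c1` (`K = ℚ(√−89)`, `d_K = −356`) in the cell's
# closing currency: `BSDp 149895d1 3`.

GEN 35 (this file SUPERSEDES the GEN 34 bytes of the same name; o5-r2 GEN 35, memo `HOME/b2b-bsdres-o5-r2/gen35/O5-GEN35.md`):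
(1) MAZUR FOR THE COMPANION. The companion-side Manin binder `hc3' : ¬ 3 ∣ c(D')` of the good companion `16655c1` (`N_G = 16655 = 5·3331`: `3 ∤ N_G`) is discharged
BY NAME from the REFEREED theorem Mazur 1978, Cor. 4.1 = tree named fact `mazur_not_dvd_maninConstant_of_odd`
(`Literature/NumberTheory/EllipticCurves/ManinConstantSemistablePrimewise.lean`, librarian 2026-08-16, BUILT; Česnavičius 2018 Thm. 1.2 (MK-1),
arXiv:1604.02165 p. 3; consumed likewise by X11b `BDPRouteManin`): globally minimal `G` (MODELS instance), optimal datum (`hopt'` = the fact's own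
binder `Λ_E ⊆ c·Λ_f`), `p = 3 ≠ 2`, `¬ 3² ∣ N'` by Carayol (`N' = N_G` from `hmod`, kernel numeral `conductorNorm_G…`) + `norm_num` — NO range
bound, NO database primary, NO registry flag. New:
`o5_bsdp_row149895d1_mazur` = the same row with `hc3'` so discharged and the RECORD-side `hc3` DISPLAYED (`3² ∣ N_W`: outside Mazur) — flag-free;
`o5_bsdp_row149895d1_manin` now use Mazur on the companion side, A321 on the record side ONLY.
(2) A321 PROVENANCE FLAGS CARRIED (referee A R199.5; REFEREE-2 R2-140.1; registry CITED-FACTS A321 = PUB[sec]): BOTH flags `CRE19-db-primary`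
+ `CNS24-range-reading` travel with every displayed `hMan` — spelled out in each `_manin` docstring below; A321 is usable AS PRINTED at
`N ≤ 300000` only, and every A321 instantiation in this file is inside the range AND the narrow ČNS population:
`N(149895d1) = 149895 = 3²·5·3331` (odd additive prime `3`).
(3) The Heegner level lemma(s) `satisfiesHeegnerHypothesis_149895_of_discr` (GEN 34 edit 3) MOVED, bytes unchanged, to part 35h
`O5/HeegnerHypothesisOfDiscr.lean` (imported; dependency-free, farm-checked rc 0) — no row file imports another row file any more.
No other change of statement; §1/§2 byte-identical to GEN 34.

GEN 34 (superseded the GEN 33 bytes): the binder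
`hW20 : Wuthrich2014.lemma20_surjective_threeAdic_of_semistable` (Wuthrich 2014, Lemma 20; registry CITED-FACTS A9)
is NO LONGER DISPLAYED — it is DISCHARGED BY NAME by the tree theorem
`Wuthrich2014.lemma20_surjective_threeAdic_of_semistable_holds`
(`Literature/NumberTheory/EllipticCurves/Wuthrich2014/ThreeAdicImageSupersingularProofs.lean`, landed 2026-08-21,
built; A9 → DISCHARGED (PROVED), CITED-FACTS l.1094), exactly as the Additive lane's `…NoLemma20` files do.
Likewise `hmodE : hasEntireLFunction_rat` (A19) is NO LONGER DISPLAYED: it is DERIVED from `hmod` by the tree theorem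
`WeierstrassCurve.hasEntireLFunction_rat_of_exists_isNewformOf` (`AnalyticRankModularityProofs.lean`, Diamond–Shurman
Thm 8.8.3 + 5.10.2), as the X11b Castella files do — the displayed modularity input is the single root fact `hmod`.
Third (GEN 34 edit 3): the Heegner-hypothesis binders `hH : SatisfiesHeegnerHypothesis N K`, `hH' : … N' K`,
`h3K : … 3 K` are NO LONGER DISPLAYED — they are DERIVED IN THE KERNEL: the decomposition law
(`satisfiesHeegnerHypothesis_iff_kronecker`, tree, PROVED) + Jacobi symbols `(d_K/p) = 1` by `norm_num` for the primes of the
literal level (`satisfiesHeegnerHypothesis_<N>_of_discr`, part 35h), Carayol (`N = N_W`, `N' = N_G` from `hmod`, as for the Manin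
discharge) and `SatisfiesHeegnerHypothesis.of_dvd` (`N_G ∣ N_W`, `3 ∣ N_W`). The remaining set-up binders
(`D`, `D'`, `K` with `hK`/`hdK`, `H`, `H'`, `ι`, `ι₃`, `P`, `P'` with `hP`/`hP'`) are pure DATA, each instantiable by a
tree theorem given `hmod` (see the GEN 34 binder census). No other change of statement.

HONEST FRAMING (cell `b2b-bsdres`, run/shared/lean/b2b/bsd-rank1-residual/, verbatim in every file): the
goal of the cell is to DELETE the COMBINATION-SHAPED residual classes of the Birch–Swinnerton-Dyer
formula for ALL analytic-rank `≤ 1` elliptic curves over `ℚ` — "full BSD formula for every rank `≤ 1`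
curve in class `C`" assembled STRICTLY from published theorems — so that the rank-`≤ 1` remainder
becomes exactly the CONSTRUCTION-SHAPED classes, which are TYPED (missing-input `Prop`s), NOT
attempted. This is not "finishing BSD". Seat o5-r2 (planner 2, non-Iwasawa side) works a RESEARCH ROUTE
on O5 = (t′); **O5 stays OPEN**; no claim beyond the stated rows; every theorem is CONDITIONAL on its
displayed binders; census / instrument statements are EVIDENCE or displayed binders, never a Literature
fact; NOTHING is booked and no mark / label / count / tier of `RESIDUAL-MAP.md` moves.

Record row (EVIDENCE, `O5/HeegnerIndexRecordsThreeRankOneT1.lean` l.301): `149895d1`, `D = −356`,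
`m₁ = m₂ = 8`, `#F(ℚ)_tors = 1`, `∏c_ℓ(F) = 16`, `#Ш_an(F) = 1` (so `ord₃ q_d = 0`).
§3 (o5-r2 GEN 33 docket (iii) / GEN 35): `o5_bsdp_row149895d1_manin` — BOTH Manin binders DISCHARGED BY NAME:
`hc3` (record, `N(149895d1) = 149895 ≤ 300000`) from lit GEN 112's A321 `cremona_abs_maninConstant_eq_one_of_level_le_300000`
(p368272; flags `CRE19-db-primary` + `CNS24-range-reading` CARRIED, see the theorem docstrings; via Carayol's level theorem
`IsNewformOf.level_eq_conductorNorm_of_exists_isNewformOf` + the kernel numerals `conductorNorm_W…`) and `hc3'` (companion `16655c1`, `N' = 16655 = 5·3331`, `3 ∤ N'`)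
from Mazur 1978 Cor. 4.1 (`mazur_not_dvd_maninConstant_of_odd`, refereed, no range, no flag), at the price of the displayed optimality `hopt`, `hopt'`
of the chosen data — NO Manin binder remains; and `o5_bsdp_row149895d1_mazur` — the flag-free variant(s) (Mazur on the companion,
record-side `hc3` DISPLAYED). §2 and the GEN 33/34 §3 were elaborated in `gen33/scratch/…` / `gen34/scratch/BSDpNoLemma20_composition_scratch.lean` (rc 0);
the GEN 35 §3 in `gen35/scratch/BSDpMazur_composition_scratch.lean` (rc in `gen35/scratch/CHECKS.md`) as real text over sorried stand-ins for the
unbuilt END / base rows (signatures verbatim), the Mazur module imported for REAL.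

References: as part 32; [CesnaviciusNeururerSaha2023] §1; [Mazur1978] Cor. 4.1; [Cesnavicius2018] Thm. 1.2 (MK-1); [AgasheRibetStein2006] Thm. 2.3, 2.6;
[DiamondShurman2005] Thm. 8.8.1; [CremonaAlgorithms1997] §3.2; [Kraus1989] Prop. 1–2; [SilvermanAEC2009] III.1, VII.1.

### cc-typer-5 GEN 20 (O5 §3.5 / O6 §3.4 typer of record) — by-name ask A-O5-G35-1 of o5-r2 GEN 35 (HOME/INBOX.md l.16133; by sha, VERBATIM + ¶; memo gen35/O5-GEN35.md §G35-6;
SUPERSEDES the A-O5-G33-1 / G34-1 versions) item (b) 2cf83c5291746f5d → O5/HeegnerLogTransportThreeBSDpRow149895d1.lean (after (h) + part 32; 25d ROW in tree). Source: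
`HOME/b2b-bsdres-o5-r2/gen35/lean/HeegnerLogTransportThreeBSDpRow149895d1.lean` sha16 `2cf83c5291746f5d` (325 l.; `gen35/SHA16.txt`; o5-r2's farm checks rc 0 / 0 warnings / 0
sorries, axioms standard, dedup clean as stated in their line), re-hashed by the typer right before writing; THIS file = the source VERBATIM + this paragraph (imports, module
text, every declaration block byte-identical; script `class-closure/typer-5/gen20/gplace.py`, docstring anchor asserted); imports `O5.HeegnerLogTransportThreeBSDp`,
`O5.HeegnerLogTransportThreeTwoSidedRow149895d1`, `Literature.NumberTheory.EllipticCurves.ManinConstantConductorLe300000`,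
`Literature.NumberTheory.EllipticCurves.ManinConstantSemistablePrimewise`, `Literature.NumberTheory.EllipticCurves.CuspFormLFunctionLevelConductorProofs`,
`Literature.NumberTheory.EllipticCurves.Wuthrich2014.ThreeAdicImageSupersingularProofs`, `Literature.NumberTheory.EllipticCurves.AnalyticRankModularityProofs`,
`O5.HeegnerHypothesisOfDiscr` — all in the tree at filing; the typer's own standalone farm check on tree imports (rc 0 / 0 warnings / 0 sorries; `#print axioms` of the END(s)
standard) and DEDUP (`lean search --decl` on the 8 new names + 2 instances: no match; the gate's statement-level dedup at dry-run) precede the proposal. CONTENT LABELS: as the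
source's module text above states (declarations: `Wd149895d1_356`, `isGloballyMinimal_Wd149895d1_356`, `twistChange356W`, `twist_W149895d1_356`, `padicValRat_u_twistChange356W`,
`o5_bsdp_row149895d1`, `o5_bsdp_row149895d1_manin`, `o5_bsdp_row149895d1_mazur`); 0 `@[conjecture]`, 0 Literature facts (net named-fact debt 0), no `sorry`; published inputs stay
displayed hypotheses BY NAME, nothing re-proved. HONEST FRAMING (cell `b2b-bsdres`): research route, lane CLASS-CLOSURE §3.5 O5; CONDITIONAL ENDs — nothing asserted beyond the
displayed binders, nothing booked, no mark / label / count / tier of `RESIDUAL-MAP.md` moves; census / instrument statements = EVIDENCE or displayed binders, never a Literature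
fact; O5 OPEN.
-/

set_option autoImplicit false

noncomputable section

open scoped Classical

open WeierstrassCurve Literature.NumberTheory.EllipticCurves
  Literature.NumberTheory.EllipticCurves.ModularForms
  Literature.NumberTheory.EllipticCurves.Rank1Residual
  Literature.NumberTheory.EllipticCurves.Rank1Residual.Typed
  Literature.NumberTheory.EllipticCurves.KrizLi2019
open Summit.BirchSwinnertonDyer.Rank1Residual.X11b (isGloballyMinimal_of_krausCriterion_support)
open IsDedekindDomain (HeightOneSpectrum)
open scoped NumberField

namespace Summit.BirchSwinnertonDyer.Rank1Residual.O5.HeegnerLogTransport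

/-! ## §1 The twist model (checked standalone, rc 0) -/

namespace KL3TwoSidedRows

/-- The tree's model of the quadratic twist `149895d1^(−356)` is already globally minimal (conductor
`149895·356² = 18997092720`, additive at `2`): `⟨0, d·b₂/4, 0, d²·b₄/2, d³·b₆/4⟩` with `b₂, b₄, b₆ = −3, −705, 11129`.
[cite: CremonaAlgorithms1997, §3.2] -/
def Wd149895d1_356 : WeierstrassCurve ℚ := ⟨0, 267, 0, -44674440, -125529600016⟩

/-- `Δ(Wd149895d1_356) = −2¹²·3⁹·5·89⁶·3331 ≠ 0`. [folklore] -/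
instance : Wd149895d1_356.IsElliptic := ⟨by
  rw [isUnit_iff_ne_zero]
  norm_num [Wd149895d1_356, WeierstrassCurve.Δ, WeierstrassCurve.b₂, WeierstrassCurve.b₄,
    WeierstrassCurve.b₆, WeierstrassCurve.b₈]⟩

/-- `Wd149895d1_356` is globally minimal: `|Δ| = 2¹²·3⁹·5·89⁶·3331`; at `2`: `2⁴ ‖ c₄`, `2⁶ ‖ c₆`, and the
integer Kraus test refutes a descaled model (`c₄/16` odd, `c₆/64 + 1 ≡ 2 mod 4`); elsewhere `v_q Δ < 12`.
[cite: SilvermanAEC2009, VII.1 Remark 1.1] [cite: Kraus1989, Prop. 1 and Prop. 2] -/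
theorem isGloballyMinimal_Wd149895d1_356 : Wd149895d1_356.IsGloballyMinimal :=
  isGloballyMinimal_of_krausCriterion_support 0 267 0 (-44674440) (-125529600016)
    [(2, 4, 12), (3, 2, 9), (5, 1, 1), (89, 2, 6), (3331, 1, 1)]
    (by intro t ht; simp only [List.mem_cons, List.not_mem_nil, or_false] at ht
        rcases ht with rfl | rfl | rfl | rfl | rfl <;> norm_num)
    (by decide +kernel) (by decide +kernel)

/-- Instance form of `isGloballyMinimal_Wd149895d1_356` (typer lint docstring). [cite: Kraus1989, Prop. 1 and Prop. 2] -/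
instance : Wd149895d1_356.IsGloballyMinimal := isGloballyMinimal_Wd149895d1_356

/-- The identity change of variables (`u = 1`). [cite: SilvermanAEC2009, III.1 Table 3.1] -/
def twistChange356W : VariableChange ℚ := ⟨1, 0, 0, 0⟩

/-- **The twist identity IN THE KERNEL**: `id • 149895d1.quadraticTwist (−356) = Wd149895d1_356`.
[cite: SilvermanAEC2009, III.1 Table 3.1 and X.5 Cor. 5.4] -/
theorem twist_W149895d1_356 :
    twistChange356W • W149895d1.quadraticTwist ((-356 : ℤ) : ℚ) = Wd149895d1_356 := by
  ext <;> norm_num [WeierstrassCurve.variableChange_def, WeierstrassCurve.quadraticTwist, W149895d1,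
    Wd149895d1_356, twistChange356W, WeierstrassCurve.b₂, WeierstrassCurve.b₄, WeierstrassCurve.b₆]

/-- `u = 1` for `twistChange356W`, so `ord₃ u = 0`. [folklore] -/
theorem padicValRat_u_twistChange356W : padicValRat 3 (twistChange356W.u : ℚ) = 0 := by
  simp [twistChange356W]

end KL3TwoSidedRows

open KL3TwoSidedRows

/-! ## §2 The row of record `149895d1 ~ 16655c1` in closing currency (mirror of `o5_bsdp_row240930b1`) -/

/-- **THE SECOND TWO-SIDED ROW OF RECORD IN CLOSING CURRENCY: `BSD(149895d1, 3)`** — part 25d's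
`o5_index_unit_row149895d1` (`W := 149895d1`, `G := 16655c1`, `Gd := Gd356`) composed with part 32 §1
(`bsdp_of_rankOne_of_indexUnit`): `P`'s non-torsion DERIVED (`r_an(W) = 1`, `q_d ≠ 0`, Gross–Zagier BY
NAME), index finiteness = Kolyvagin BY NAME, `u = 1`, twist identity and minimality in the kernel (§1),
`3 ∤ ∏c(W)` = `tam3_W149895d1`. Displayed: `hKL`, `hYZ`, `hmod`, `hGZK`
(GEN 34: `hW20` = Wuthrich L.20 DISCHARGED BY NAME; `hmodE` DERIVED from `hmod`; `hH`, `hH'`, `h3K` DERIVED in the kernel); `hGZ`, `hKo`, `hB`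
(`W/K`); `hKoG`, `hGZG`; row data `hρ`, `hr`, Heegner data over `d_K = −356`, `hP'inf`, `hSelG`, `hSelGd`,
`hc3`, `hc3'`, `q_d` (`hqd`, `hqd0`, `hvd`). Conditional theorem; research route; O5 OPEN; nothing booked.
[cite: KrizLi2019, Theorem 1.16 (arXiv:1609.06687v4 pp. 7-8)] [cite: McCallumLMS1991, §1 Theorem (Kolyvagin), p. 296]
[cite: GrossZagier1986, Thm. I.6.3] [cite: Kolyvagin1990, Thm. A] [cite: YanZhu2026, Theorem 4.15]
[cite: CremonaAlgorithms1997, Table 1] -/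
theorem o5_bsdp_row149895d1
    (hKL : KrizLi2019.thm116_padicLogHeegner_congruence)
    (hYZ : YanZhu2026.thm415_padicValRat_bsd_rank_le_one)
    (hmod : exists_isNewformOf)
    (hGZK : rank_eq_analyticRank_of_analyticRank_le_one)
    (hρ : W149895d1.HasSurjectiveModNGaloisRep 3) (hr : W149895d1.analyticRank = 1)
    {N N' : ℕ} [NeZero N] [NeZero N'] (D : ModularParametrizationData W149895d1 N)
    (D' : ModularParametrizationData G16655c1 N')
    (K : Type) [Field K] [NumberField K] (hK : IsImaginaryQuadratic K) (hdK : NumberField.discr K = -356)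
    (hGZ : gross_zagier N W149895d1 K) (hKo : kolyvagin N W149895d1 K)
    (hB : Kolyvagin1990_padicValNat_card_sha_le N W149895d1 K)
    (hKoG : kolyvagin N' G16655c1 K) (hGZG : gross_zagier N' G16655c1 K)
    (H : HeegnerDatum N (NumberField.discr K)) (H' : HeegnerDatum N' (NumberField.discr K))
    (ι : K →+* ℂ) (ι₃ : K →+* ℚ_[3])
    (P : (W149895d1.baseChange K).toAffine.Point) (P' : (G16655c1.baseChange K).toAffine.Point)
    (hP : WeierstrassCurve.Affine.Point.map ι.toRatAlgHom P = heegnerPointComplex D H)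
    (hP' : WeierstrassCurve.Affine.Point.map ι.toRatAlgHom P' = heegnerPointComplex D' H')
    (hP'inf : ¬ IsOfFinAddOrder P')
    (hSelG : Nat.card (G16655c1.selmerGroup (3 : ℤ)) = 3 ^ G16655c1.mordellWeilRank)
    (hSelGd : Nat.card (Gd356.selmerGroup (3 : ℤ)) = 3 ^ Gd356.mordellWeilRank)
    (hc3 : ¬ ((3 : ℤ) ∣ D.maninConstant)) (hc3' : ¬ ((3 : ℤ) ∣ D'.maninConstant))
    (qd : ℚ) (hqd : Wd149895d1_356.entireLFunction 1 / (Wd149895d1_356.realPeriodRat : ℂ) = (qd : ℂ))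
    (hqd0 : qd ≠ 0) (hvd : padicValRat 3 qd = 0) :
    BSDp W149895d1 3 := by
  have hN : N = 149895 :=
    (IsNewformOf.level_eq_conductorNorm_of_exists_isNewformOf hmod D.isNewformOf).trans conductorNorm_W149895d1
  have hN' : N' = 16655 :=
    (IsNewformOf.level_eq_conductorNorm_of_exists_isNewformOf hmod D'.isNewformOf).trans conductorNorm_G16655c1
  have hHK : SatisfiesHeegnerHypothesis 149895 K := satisfiesHeegnerHypothesis_149895_of_discr hK.1 hdK
  have hH : SatisfiesHeegnerHypothesis N K := by rw [hN]; exact hHK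
  have hH' : SatisfiesHeegnerHypothesis N' K := by rw [hN']; exact hHK.of_dvd (by norm_num)
  have h3K : SatisfiesHeegnerHypothesis 3 K := hHK.of_dvd (by norm_num)
  have hd : NumberField.discr K < -4 := by rw [hdK]; norm_num
  have hc : ¬ ((3 : ℕ) : ℤ) ∣ D.c := by rw [Nat.cast_ofNat]; exact hc3
  have hWd : twistChange356W • W149895d1.quadraticTwist (NumberField.discr K : ℚ) = Wd149895d1_356 := by
    rw [hdK]; exact twist_W149895d1_356
  exact bsdp_of_rankOne_of_indexUnit W149895d1 3 N K D H ι P hGZ hKo hB hGZK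
    (hasEntireLFunction_rat_of_exists_isNewformOf hmod)
    hK hH hd hP
    (by decide) hc hr hρ Wd149895d1_356 twistChange356W hWd padicValRat_u_twistChange356W qd hqd hqd0 hvd
    tam3_W149895d1 fun hPinf =>
      o5_index_unit_row149895d1 hKL hYZ
        Wuthrich2014.lemma20_surjective_threeAdic_of_semistable_holds
        hmod hGZK hρ D D' K hK hdK hH hH' h3K hKoG hGZG H H' ι ι₃ P P'
        hP hP' hPinf hP'inf hSelG hSelGd (padicValInt.eq_zero_of_not_dvd hc3) hc3'

/-! ## §3 The same row(s) with the Manin binder(s) discharged BY NAME — record side: A321 (lit GEN 112, p368272; flags `CRE19-db-primary` +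
`CNS24-range-reading` carried, `N ≤ 300000`); companion side: Mazur 1978 Cor. 4.1 (`mazur_not_dvd_maninConstant_of_odd`); and the flag-free
Mazur-only variant(s) `_mazur` (o5-r2 GEN 33 docket (iii) / GEN 35) -/

/-- **Row `149895d1` in closing currency with BOTH Manin binders discharged BY NAME** (o5-r2 GEN 33 docket (iii); GEN 35: Mazur on the
companion side, A321 flags carried on the record side).
RECORD side — `hc3 : ¬ 3 ∣ c(D)` (record `149895d1`, additive at `3`: `N = N(149895d1) = 149895 = 3²·5·3331`, `3² ∣ N`, so Mazur 1978 Cor. 4.1 does NOT apply) is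
REPLACED by the named fact `hMan` = `cremona_abs_maninConstant_eq_one_of_level_le_300000` (lit GEN 112, p368272, `Literature/…/
ManinConstantConductorLe300000.lean`: Cremona's completed verification `|c| = 1` for every optimal curve of conductor `≤ 300000`, as cited in print by
Česnavičius–Neururer–Saha, JEMS 26 (2024) §1; corollary `not_dvd_maninConstant_of_level_le_300000`) + the optimality `hopt` of the chosen datum
(`Λ_E ⊆ c·Λ_f`, the fact's own binder), the bound `N ≤ 300000` by Carayol's level theorem (from `hmod`) + the kernel numeral `conductorNorm_W149895d1`.
PROVENANCE FLAGS CARRIED WITH `hMan` (registry CITED-FACTS A321, tier PUB[sec]; referee A R199.5; REFEREE-2 R2-140.1 — BOTH flags travel to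
every consumer row): `CRE19-db-primary` (the refereed SECONDARY sentence asserts the statement for `N ≤ 300000`; the PRIMARY is Cremona's database
documentation `ecdata/manin.txt`, unrefereed beyond the Agashe–Ribet–Stein 2006 appendix, A54, bound `130000`) and `CNS24-range-reading` (narrowest
honest reading of the ČNS population = isogeny classes of conductor `≤ 300000` WITH an odd additive prime); usable AS PRINTED at `N ≤ 300000` ONLY.
THIS instantiation is inside the range AND the narrow population: `N = 149895 = 3²·5·3331 ≤ 300000`, odd additive prime `3`; it is the ONLY A321 use here.
COMPANION side — `hc3' : ¬ 3 ∣ c(D')` (good companion `16655c1`: `N' = N(16655c1) = 16655 = 5·3331`, `3 ∤ N'`) is REPLACED by the REFEREED theorem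
Mazur 1978, Cor. 4.1 BY NAME: `hMaz` = `mazur_not_dvd_maninConstant_of_odd` (`Literature/NumberTheory/EllipticCurves/
ManinConstantSemistablePrimewise.lean`, librarian 2026-08-16, BUILT; = (MK-1) of Česnavičius 2018 Thm. 1.2, arXiv:1604.02165 p. 3: "for a new elliptic
optimal quotient `π : J₀(n) ↠ E` and a prime `p`, if `ord_p(n) ≤ 1` then `ord_p(c_π) = 0` … (MK-1) if `p` is odd (Mazur, [Maz78] Cor. 4.1)";
consumed the same way by X11b `BDPRouteManin`)
+ the optimality `hopt'` of the chosen companion datum: globally minimal `16655c1` (instance, 25d MODELS `…TwoSidedRow149895d1Models` l.178), `p = 3 ≠ 2` (`decide`),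
`¬ 3² ∣ N'` by Carayol (`N' = 16655`, kernel numeral `conductorNorm_G16655c1`) + `norm_num` — no range bound, no database primary, NO flag.
NO Manin binder remains on this row. Everything else exactly as `o5_bsdp_row149895d1`.
Conditional theorem; research route; O5 OPEN; nothing booked; census rows = EVIDENCE.
[cite: CesnaviciusNeururerSaha2023, §1 (arXiv:1911.09446v3 text chunk 3 L70-72)] [cite: AgasheRibetStein2006, Thm. 2.6]
[cite: Mazur1978, Cor. 4.1] [cite: Cesnavicius2018, Thm. 1.2 (MK-1) (arXiv:1604.02165 text chunk 3 L49-59)]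
[cite: DiamondShurman2005, Thm. 8.8.1] -/
theorem o5_bsdp_row149895d1_manin
    (hKL : KrizLi2019.thm116_padicLogHeegner_congruence)
    (hYZ : YanZhu2026.thm415_padicValRat_bsd_rank_le_one)
    (hmod : exists_isNewformOf)
    (hGZK : rank_eq_analyticRank_of_analyticRank_le_one)
    (hρ : W149895d1.HasSurjectiveModNGaloisRep 3) (hr : W149895d1.analyticRank = 1)
    {N N' : ℕ} [NeZero N] [NeZero N'] (D : ModularParametrizationData W149895d1 N)
    (D' : ModularParametrizationData G16655c1 N')
    (K : Type) [Field K] [NumberField K] (hK : IsImaginaryQuadratic K) (hdK : NumberField.discr K = -356)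
    (hGZ : gross_zagier N W149895d1 K) (hKo : kolyvagin N W149895d1 K)
    (hB : Kolyvagin1990_padicValNat_card_sha_le N W149895d1 K)
    (hKoG : kolyvagin N' G16655c1 K) (hGZG : gross_zagier N' G16655c1 K)
    (H : HeegnerDatum N (NumberField.discr K)) (H' : HeegnerDatum N' (NumberField.discr K))
    (ι : K →+* ℂ) (ι₃ : K →+* ℚ_[3])
    (P : (W149895d1.baseChange K).toAffine.Point) (P' : (G16655c1.baseChange K).toAffine.Point)
    (hP : WeierstrassCurve.Affine.Point.map ι.toRatAlgHom P = heegnerPointComplex D H)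
    (hP' : WeierstrassCurve.Affine.Point.map ι.toRatAlgHom P' = heegnerPointComplex D' H')
    (hP'inf : ¬ IsOfFinAddOrder P')
    (hSelG : Nat.card (G16655c1.selmerGroup (3 : ℤ)) = 3 ^ G16655c1.mordellWeilRank)
    (hSelGd : Nat.card (Gd356.selmerGroup (3 : ℤ)) = 3 ^ Gd356.mordellWeilRank)
    (hMan : cremona_abs_maninConstant_eq_one_of_level_le_300000)
    (hMaz : mazur_not_dvd_maninConstant_of_odd)
    (hopt : ∀ z ∈ D.L.lattice, ∃ w ∈ periodLattice D.f, z = D.c * w)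
    (hopt' : ∀ z ∈ D'.L.lattice, ∃ w ∈ periodLattice D'.f, z = D'.c * w)
    (qd : ℚ) (hqd : Wd149895d1_356.entireLFunction 1 / (Wd149895d1_356.realPeriodRat : ℂ) = (qd : ℂ))
    (hqd0 : qd ≠ 0) (hvd : padicValRat 3 qd = 0) :
    BSDp W149895d1 3 :=
  o5_bsdp_row149895d1 hKL hYZ hmod hGZK hρ hr D D' K hK hdK hGZ hKo hB hKoG hGZG H H'
    ι ι₃ P P' hP hP' hP'inf hSelG hSelGd
    (not_dvd_maninConstant_of_level_le_300000 hMan W149895d1 D hopt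
      (((IsNewformOf.level_eq_conductorNorm_of_exists_isNewformOf hmod D.isNewformOf).trans
        conductorNorm_W149895d1).le.trans (by norm_num)) Nat.prime_three)
    (hMaz G16655c1 D' hopt' 3 Nat.prime_three (by decide)
      (by rw [(IsNewformOf.level_eq_conductorNorm_of_exists_isNewformOf hmod D'.isNewformOf).trans
        conductorNorm_G16655c1]; norm_num))
    qd hqd hqd0 hvd

/-- **Row `149895d1` in closing currency with the COMPANION-side Manin binder discharged BY NAME from Mazur 1978, Cor. 4.1 — flag-free**
(o5-r2 GEN 35): `hc3' : ¬ 3 ∣ c(D')` (good companion `16655c1`: `N' = N(16655c1) = 16655 = 5·3331`, `3 ∤ N'`, a fortiori `3² ∤ N'`) is REPLACED by the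
REFEREED theorem Mazur 1978, Cor. 4.1 BY NAME: `hMaz` = `mazur_not_dvd_maninConstant_of_odd` (`Literature/NumberTheory/EllipticCurves/
ManinConstantSemistablePrimewise.lean`, librarian 2026-08-16, BUILT; = (MK-1) of Česnavičius 2018 Thm. 1.2, arXiv:1604.02165 p. 3: "for a new elliptic
optimal quotient `π : J₀(n) ↠ E` and a prime `p`, if `ord_p(n) ≤ 1` then `ord_p(c_π) = 0` … (MK-1) if `p` is odd (Mazur, [Maz78] Cor. 4.1)";
consumed the same way by X11b `BDPRouteManin`)
and the optimality `hopt'` of the chosen companion datum (`Λ_E ⊆ c·Λ_f`, the fact's own binder): globally minimal `16655c1` (instance,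
25d MODELS `…TwoSidedRow149895d1Models` l.178), `p = 3 ≠ 2` (`decide`), `¬ 3² ∣ N'` by Carayol's level theorem `IsNewformOf.level_eq_conductorNorm_of_exists_isNewformOf`
(from `hmod`) + the kernel numeral `conductorNorm_G16655c1` + `norm_num`. No range bound, no database primary, NO registry flag travels with this discharge.
The RECORD-side binder `hc3 : ¬ 3 ∣ c(D)` stays DISPLAYED: `N(149895d1) = 149895 = 3²·5·3331` has `3² ∣ N` — outside Mazur's hypothesis
(A321 = `cremona_abs_maninConstant_eq_one_of_level_le_300000` discharges it, WITH its two provenance flags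
`CRE19-db-primary` + `CNS24-range-reading`: see `o5_bsdp_row149895d1_manin`; this theorem is the flag-free variant).
Everything else exactly as `o5_bsdp_row149895d1`.
Conditional theorem; research route; O5 OPEN; nothing booked; census rows = EVIDENCE.
[cite: Mazur1978, Cor. 4.1] [cite: Cesnavicius2018, Thm. 1.2 (MK-1) (arXiv:1604.02165 text chunk 3 L49-59)]
[cite: AgasheRibetStein2006, Thm. 2.3] [cite: DiamondShurman2005, Thm. 8.8.1] -/
theorem o5_bsdp_row149895d1_mazur
    (hKL : KrizLi2019.thm116_padicLogHeegner_congruence)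
    (hYZ : YanZhu2026.thm415_padicValRat_bsd_rank_le_one)
    (hmod : exists_isNewformOf)
    (hGZK : rank_eq_analyticRank_of_analyticRank_le_one)
    (hρ : W149895d1.HasSurjectiveModNGaloisRep 3) (hr : W149895d1.analyticRank = 1)
    {N N' : ℕ} [NeZero N] [NeZero N'] (D : ModularParametrizationData W149895d1 N)
    (D' : ModularParametrizationData G16655c1 N')
    (K : Type) [Field K] [NumberField K] (hK : IsImaginaryQuadratic K) (hdK : NumberField.discr K = -356)
    (hGZ : gross_zagier N W149895d1 K) (hKo : kolyvagin N W149895d1 K)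
    (hB : Kolyvagin1990_padicValNat_card_sha_le N W149895d1 K)
    (hKoG : kolyvagin N' G16655c1 K) (hGZG : gross_zagier N' G16655c1 K)
    (H : HeegnerDatum N (NumberField.discr K)) (H' : HeegnerDatum N' (NumberField.discr K))
    (ι : K →+* ℂ) (ι₃ : K →+* ℚ_[3])
    (P : (W149895d1.baseChange K).toAffine.Point) (P' : (G16655c1.baseChange K).toAffine.Point)
    (hP : WeierstrassCurve.Affine.Point.map ι.toRatAlgHom P = heegnerPointComplex D H)
    (hP' : WeierstrassCurve.Affine.Point.map ι.toRatAlgHom P' = heegnerPointComplex D' H')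
    (hP'inf : ¬ IsOfFinAddOrder P')
    (hSelG : Nat.card (G16655c1.selmerGroup (3 : ℤ)) = 3 ^ G16655c1.mordellWeilRank)
    (hSelGd : Nat.card (Gd356.selmerGroup (3 : ℤ)) = 3 ^ Gd356.mordellWeilRank)
    (hMaz : mazur_not_dvd_maninConstant_of_odd)
    (hc3 : ¬ ((3 : ℤ) ∣ D.maninConstant))
    (hopt' : ∀ z ∈ D'.L.lattice, ∃ w ∈ periodLattice D'.f, z = D'.c * w)
    (qd : ℚ) (hqd : Wd149895d1_356.entireLFunction 1 / (Wd149895d1_356.realPeriodRat : ℂ) = (qd : ℂ))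
    (hqd0 : qd ≠ 0) (hvd : padicValRat 3 qd = 0) :
    BSDp W149895d1 3 :=
  o5_bsdp_row149895d1 hKL hYZ hmod hGZK hρ hr D D' K hK hdK hGZ hKo hB hKoG hGZG H H'
    ι ι₃ P P' hP hP' hP'inf hSelG hSelGd
    hc3
    (hMaz G16655c1 D' hopt' 3 Nat.prime_three (by decide)
      (by rw [(IsNewformOf.level_eq_conductorNorm_of_exists_isNewformOf hmod D'.isNewformOf).trans
        conductorNorm_G16655c1]; norm_num))
    qd hqd hqd0 hvd

end Summit.BirchSwinnertonDyer.Rank1Residual.O5.HeegnerLogTransport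

end
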